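import Summits.Ventures.DiscreteObjects.Hadamard.ElemAbelianAction

/-!
# Hadamard 668 census, family F12 — no `C_p × C_p` of signed automorphisms for `p ∈ {13, 37, 41, 83, 167}` (kernel)

Framing: lottery ticket; floor = certified bounds/negative ranges.

Cell pub-namedobj (venture DiscreteObjects), target (H), hadamard gen 16.  **Rank-2 elementary abelian subgroups, large
primes.**  Let `(α, α', d₁, e₁)`, `(β, β', d₂, e₂)` be signed-permutation automorphisms of a Hadamard matrix of order `668`
with `α^p = β^p = α'^p = β'^p = 1`, commuting permutation parts, and `α, β` INDEPENDENT (`α^a β^b = 1` with `a, b < p`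
only for `a = b = 0`, i.e. `⟨α, β⟩ ≅ C_p × C_p` on the rows), `p` prime, `13 ≤ p`, `p ≠ 23`.  By the fixed-structure census
(`hadamard668_signedAut_fixedRows`, gens 5–9) every one of the `p² − 1` non-identity elements `α^a β^b` fixes exactly
`c_p` rows, `(p, c_p) ∈ {(13,44), (37,2), (41,12), (83,4), (167,0)}`; Burnside's lemma (`sq_dvd_sum_card_fixed_pair`) demands
`p² ∣ 668 + (p² − 1)·c_p`, i.e. `169 ∣ 8060`, `1369 ∣ 3404`, `1681 ∣ 20828`, `6889 ∣ 28220`, `27889 ∣ 668` — all false.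
**`no_hadamard668_elemAbelian_rank2_large`**: no such pair exists.  With `hadamard668_signedAut_not_dvd_orderOf_sq`
(PrimeSquareOrder, p268777: no element of order `p²`, `p ≥ 11`) this says: **for `p ∈ {13, 37, 41, 83, 167}` the Sylow
`p`-subgroups of the signed automorphism group of any H(668) are trivial or of order `p`** (a group of order `p²` is
`C_{p²}` or `C_p × C_p`).  The case `p = 23` (fixed rows `1` or `24`, Burnside consistent) needs orthogonality and is
`ElemAbelianRank2_23`; `p = 11` dies at the summed orbit level (E1 script, FAMILY-F12-G16 §3), `p ∈ {3, 5, 7}` do not.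
Ours, not literature (nearest print: Lander 1983 ch. 3 treats cyclic groups of prime order; Aschbacher 1971 needs
`p > λ = 166`); no `sorry`, no `native_decide`.
-/

namespace Summit.Ventures.DiscreteObjects.Hadamard

open Finset BigOperators

open Literature.Combinatorics.Designs.GoethalsSeidel (IsHadamardMatrix)

variable {ι : Type*} [Fintype ι] [DecidableEq ι]

/-- summing a function on `(ℤ/p)²` that is `c` away from the identity and `n` at the identity -/
lemma sum_pair_const (p : ℕ) [Fact p.Prime] (f : Multiplicative (ZMod p × ZMod p) → ℕ) (n c : ℕ)
    (h1 : f 1 = n) (hc : ∀ g, g ≠ 1 → f g = c) :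
    ∑ g, f g = n + (p ^ 2 - 1) * c := by
  classical
  have hcard : Fintype.card (Multiplicative (ZMod p × ZMod p)) = p ^ 2 := by
    rw [Fintype.card_multiplicative, Fintype.card_prod, ZMod.card, sq]
  rw [← Finset.sum_erase_add _ _ (Finset.mem_univ (1 : Multiplicative (ZMod p × ZMod p))), h1,
    Finset.sum_congr rfl (fun g hg => hc g (Finset.ne_of_mem_erase hg)), Finset.sum_const, smul_eq_mul,
    Finset.card_erase_of_mem (Finset.mem_univ _), Finset.card_univ, hcard]
  ring

/-- **No `C_p × C_p` of signed automorphisms of an H(668) for `p ∈ {13, 37, 41, 83, 167}`.**  Two signed-permutation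
automorphisms whose permutation parts commute, have `p`-th power `1`, and are independent on the rows
(`α^a β^b = 1`, `a, b < p` ⇒ `a = b = 0`) do not exist for `p` prime, `13 ≤ p ≠ 23`. -/
theorem no_hadamard668_elemAbelian_rank2_large {H : Matrix ι ι ℤ} (hH : IsHadamardMatrix H)
    (hι : Fintype.card ι = 668) (p : ℕ) (hp : p.Prime) (hp13 : 13 ≤ p) (hp23 : p ≠ 23)
    {α α' β β' : Equiv.Perm ι} {d₁ e₁ d₂ e₂ : ι → ℤ}
    (hA : IsSignedAut H α α' d₁ e₁) (hB : IsSignedAut H β β' d₂ e₂)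
    (hα : α ^ p = 1) (hα' : α' ^ p = 1) (hβ : β ^ p = 1) (hβ' : β' ^ p = 1)
    (hc : Commute α β) (hc' : Commute α' β')
    (hind : ∀ a b : ℕ, a < p → b < p → α ^ a * β ^ b = 1 → a = 0 ∧ b = 0) : False := by
  classical
  haveI : Fact p.Prime := ⟨hp⟩
  -- the fixed count of every non-identity element
  set c : ℕ := if p = 13 then 44 else if p = 37 then 2 else if p = 41 then 12 else if p = 83 then 4 else 0 with hcdef
  set f : Multiplicative (ZMod p × ZMod p) → ℕ := fun g =>
    (univ.filter fun i => (α ^ (Multiplicative.toAdd g).1.val * β ^ (Multiplicative.toAdd g).2.val) i = i).card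
    with hfdef
  have hmem : p = 13 ∨ p = 37 ∨ p = 41 ∨ p = 83 ∨ p = 167 := by
    -- use the element β^0 α^1, i.e. g = ofAdd (1, 0): its census membership
    obtain ⟨d, e, haut⟩ := isSignedAut_pair p hA hB (Multiplicative.ofAdd ((1 : ZMod p), (0 : ZMod p)))
    have hg : Multiplicative.ofAdd ((1 : ZMod p), (0 : ZMod p)) ≠ 1 := by
      intro h
      have h' := congrArg (fun x => (Multiplicative.toAdd x).1) h
      simp only [toAdd_ofAdd, toAdd_one, Prod.fst_zero] at h'
      exact one_ne_zero h'
    have hne := pairPerm_ne_one p α β hind hg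
    have hfr := (hadamard668_signedAut_fixedRows hH hι p hp hp13 _ _ d e haut
      (pairPerm_pow_p p α β hα hβ hc _) (pairPerm_pow_p p α' β' hα' hβ' hc' _) (Or.inl hne)).2
    rcases hfr with ⟨h, -⟩ | ⟨h, -⟩ | ⟨h, -⟩ | ⟨h, -⟩ | ⟨h, -⟩ | ⟨h, -⟩
    · exact Or.inl h
    · exact absurd h hp23
    · exact Or.inr (Or.inl h)
    · exact Or.inr (Or.inr (Or.inl h))
    · exact Or.inr (Or.inr (Or.inr (Or.inl h)))
    · exact Or.inr (Or.inr (Or.inr (Or.inr h)))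
  have hfg : ∀ g : Multiplicative (ZMod p × ZMod p), g ≠ 1 → f g = c := by
    intro g hg
    obtain ⟨d, e, haut⟩ := isSignedAut_pair p hA hB g
    have hne := pairPerm_ne_one p α β hind hg
    have hfr := (hadamard668_signedAut_fixedRows hH hι p hp hp13 _ _ d e haut
      (pairPerm_pow_p p α β hα hβ hc g) (pairPerm_pow_p p α' β' hα' hβ' hc' g) (Or.inl hne)).2
    simp only [hfdef]
    rcases hfr with ⟨h, h2⟩ | ⟨h, -⟩ | ⟨h, h2⟩ | ⟨h, h2⟩ | ⟨h, h2⟩ | ⟨h, h2⟩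
    · rw [h2, hcdef, h]; simp
    · exact absurd h hp23
    · rw [h2, hcdef, h]; simp
    · rw [h2, hcdef, h]; simp
    · rw [h2, hcdef, h]; simp
    · rw [h2, hcdef, h]; simp
  have hf1 : f 1 = 668 := by
    simp only [hfdef, toAdd_one, Prod.fst_zero, Prod.snd_zero, ZMod.val_zero, pow_zero, mul_one,
      Equiv.Perm.one_apply]
    rw [Finset.filter_true_of_mem (fun _ _ => trivial), Finset.card_univ, hι]
  have hsum := sum_pair_const p f 668 c hf1 hfg
  have hdvd := sq_dvd_sum_card_fixed_pair p α β hα hβ hc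
  rw [show (∑ g : Multiplicative (ZMod p × ZMod p),
      (univ.filter fun i => (α ^ (Multiplicative.toAdd g).1.val * β ^ (Multiplicative.toAdd g).2.val) i = i).card)
      = ∑ g, f g from rfl, hsum] at hdvd
  rcases hmem with h | h | h | h | h <;> subst h <;> simp only [hcdef] at hdvd <;> norm_num at hdvd

end Summit.Ventures.DiscreteObjects.Hadamard
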